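import Summits.Ventures.CertifiedArithmetic.LowPrec.GemmFirstRegimeWindowZ
import Summits.Ventures.CertifiedArithmetic.LowPrec.GemmFirstRegimeLawAll
import HarnessLib

/-!
# GEMM worst case LXIX-d — THE WINDOW past the first regime, part 4:
# `R(x, n₀ + k) ≤ max(k/(B+k), k/(T+k))` for every word and every `k ≤ T/2 + 4`

HONEST FRAMING: certified error envelopes and provably optimal rounding/accumulation schemes for
low-precision formats under stated cost models; every table by two implementations; no hardware or
vendor claims.

Setting of files LXII-a/LXIII-a/LXIV-c (grid alphabet `x j = z_j/2^G`, `|z_j| ≤ M`, odd only when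
`|z_j| ≤ m₀`; `T = 2^(manBits+1)`; exact prefix `M j₀ + m₀ < T`; `M(j₀+2) + Q = 2T`; entry-mass
hypothesis `H_B`).  THEOREM (`relErr_le_window_all`, gemm.tex Prop. p:fpW): for EVERY word and
every `k = d + 1 ≤ T/2 + 4`, provided `Q ≥ 4M + 5` (the first five arguments after the exact
prefix stay below `2T`) and `manBits ≥ 3`,
`R(x, j₀+1+d) ≤ max((d+1)/(B+d+1), (d+1)/(T+d+1))`.
On `k ≤ T/2` this is implied by the first-regime law of file LXIV-c (second term `d/(T+d)`); the
content is the window `T/2 < k ≤ T/2 + 4`, where the first-regime VALUE `k/(T+k)` persists although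
the hypothesis `k ≤ T/2` of every first-regime theorem (files XLIX–LXIV) fails, and beyond which it
stops (`k ≥ T/2 + 5`: the level-`2T` family of file LXVIII exceeds it).

* LOW words: file LXIII-a verbatim (`lowInvG_of_low`, `relErr_le_of_lowInvG`, `d/(T+d) ≤ (d+1)/(T+d+1)`).
* HIGH words: the bridge to the integer model for `d + 1 ≤ T/2 + 4` (`toRat_seqSum_eq_accZ_window`:
  the a-priori growth keeps every argument in range when `manBits ≥ 3`), the five level-0
  arguments from `Q ≥ 4M + 5`, the parity of the exact prefix (`KZ_shapeG`), and `windowZ_abs`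
  (file LXIX-c): `(T+d+1)|ŝ_n - s_n| ≤ (d+1) L_n`.
* `gridW_le_window_all`: the same for the worst case `W` of any alphabet with `H_B` for every word.
The rows (E2M1² every `p ≥ 10`, binary16 `n ≤ 1043`, binary32 `k ≤ 2^23 + 4`) are file LXIX-e.

References: [Higham2002, §4.2], [IEEE7542019, §4.3.1], [LangeRump2019], [BoldoEtAl2023, Thm 4.5].
-/

namespace Summit.Ventures.CertifiedArithmetic.LowPrec.Gemm

open Literature.ComputerArithmetic.FloatingPoint
open Literature.ComputerArithmetic.FloatingPoint.MiniFloat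
open Finset

variable {φ : Format}

section Grid

variable {G M m0 E : ℕ} {x : ℕ → ℚ}
  (hx : ∀ j, ∃ z : ℤ, x j = (z : ℚ) / 2 ^ G ∧ z.natAbs ≤ M ∧ (z % 2 = 0 ∨ z.natAbs ≤ m0))
  (hq : φ.qexp ≤ -(G : ℤ)) (hR : (2 : ℚ) ^ (φ.manBits + E + 3) ≤ φ.maxRat)
  (hm0M : m0 ≤ M) (hMT : M ≤ 2 ^ (φ.manBits + 1)) (hm0 : 1 ≤ m0) (hME : M ≤ 2 ^ (G + E))
include hx hq hR hm0M hMT hm0 hME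

omit hm0 in
/-- THE BRIDGE up to `d + 1 ≤ T/2 + 4` (`manBits ≥ 3`): every accumulator `ŝ_i`, `i ≤ j₀+1+d`, is
the integer model's `accZ i / 2^G` (no step leaves the finite range). [cell] -/
theorem toRat_seqSum_eq_accZ_window {j0 Q d : ℕ} (hm : 3 ≤ φ.manBits)
    (hj0 : M * j0 + m0 < 2 ^ (φ.manBits + 1))
    (hQ : M * (j0 + 2) + Q = 2 * 2 ^ (φ.manBits + 1)) (hd : d + 1 ≤ 2 ^ φ.manBits + 4) :
    ∀ i ≤ j0 + 1 + d, (seqSum φ x i).toRat = (accZ φ.manBits (zl G x) i : ℚ) / 2 ^ G := by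
  have hGpos : (0 : ℚ) < 2 ^ G := by positivity
  have hR' : (2 : ℚ) ^ (φ.manBits + (E + 3)) ≤ φ.maxRat := by rwa [← add_assoc]
  -- the range bound in grid units
  have hbig : M * (j0 + 2) + 2 * (M * (d + 1)) < 2 ^ (φ.manBits + (E + 3) + G) := by
    have h1 : M * (d + 1) ≤ 2 ^ (G + E + φ.manBits) + 4 * 2 ^ (G + E) :=
      calc M * (d + 1) ≤ 2 ^ (G + E) * (2 ^ φ.manBits + 4) := Nat.mul_le_mul hME hd
        _ = 2 ^ (G + E + φ.manBits) + 4 * 2 ^ (G + E) := by rw [pow_add 2 (G + E)]; ring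
    have h8 : 8 ≤ 2 ^ φ.manBits :=
      le_trans (by norm_num) (Nat.pow_le_pow_right (by norm_num) hm)
    have h3 : 8 * 2 ^ (G + E) ≤ 2 ^ (G + E + φ.manBits) := by
      rw [pow_add 2 (G + E), mul_comm]; exact Nat.mul_le_mul_left _ h8
    have h6 : 2 ^ φ.manBits ≤ 2 ^ (G + E + φ.manBits) :=
      Nat.pow_le_pow_right (by norm_num) (by omega)
    have h4 : 2 ^ (φ.manBits + (E + 3) + G) = 8 * 2 ^ (G + E + φ.manBits) := by
      rw [show φ.manBits + (E + 3) + G = (G + E + φ.manBits) + 3 by omega, pow_add]; ring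
    have h5 : 2 ^ (φ.manBits + 1) = 2 * 2 ^ φ.manBits := by rw [pow_succ]; ring
    omega
  have hMj : M ≤ M * (j0 + 2) + 2 * (M * (d + 1)) :=
    le_trans (Nat.le_mul_of_pos_right M (by omega)) (Nat.le_add_right _ _)
  have hxz := zl_spec hx
  intro i
  induction i with
  | zero =>
      intro _
      obtain ⟨hz, hzM, -⟩ := hxz 0
      show (roundNE φ (x 0)).toRat = (rneZ φ.manBits (zl G x 0) : ℚ) / 2 ^ G
      rw [hz]
      exact toRat_roundNE_grid_prec hq _
        (grid_le_maxRat_of_lt hR' (lt_of_le_of_lt (le_trans hzM hMj) hbig))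
  | succ i ih =>
      intro hi
      have ih' := ih (by omega)
      obtain ⟨hz, hzM, -⟩ := hxz (i + 1)
      show (roundNE φ ((seqSum φ x i).toRat + x (i + 1))).toRat
        = (rneZ φ.manBits (accZ φ.manBits (zl G x) i + zl G x (i + 1)) : ℚ) / 2 ^ G
      have hsum : (seqSum φ x i).toRat + x (i + 1)
          = ((accZ φ.manBits (zl G x) i + zl G x (i + 1) : ℤ) : ℚ) / 2 ^ G := by
        rw [ih', hz]; push_cast; ring
      rw [hsum]
      refine toRat_roundNE_grid_prec hq _ (grid_le_maxRat_of_lt hR' (lt_of_le_of_lt ?_ hbig))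
      apply natAbs_le_of_abs_cast_le
      have habs : |(((accZ φ.manBits (zl G x) i + zl G x (i + 1) : ℤ) : ℚ))|
          = |(seqSum φ x i).toRat + x (i + 1)| * 2 ^ G := by
        rw [hsum, abs_div, abs_of_pos hGpos, div_mul_cancel₀ _ (ne_of_gt hGpos)]
      rw [habs]
      have h1 := abs_add_le (seqSum φ x i).toRat (x (i + 1))
      have h2 : |x (i + 1)| ≤ (M : ℚ) / 2 ^ G := by
        rw [hz, abs_div, abs_of_pos hGpos, ← Int.cast_abs, Int.abs_eq_natAbs, Int.cast_natCast]
        exact div_le_div_of_nonneg_right (by exact_mod_cast hzM) hGpos.le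
      have h3 : |(seqSum φ x i).toRat|
          ≤ ((M : ℚ) * ((j0 + 1 : ℕ) : ℚ) + 2 * M * ((d + 1 : ℕ) : ℚ)) / 2 ^ G := by
        rcases le_or_gt i j0 with hij | hij
        · rw [seqSum_exact_prefixG hx hq hR hm0M hMT hj0 i hij]
          refine le_trans (abs_sum_le_sum_abs _ _) (le_trans (sum_abs_leG hx (i + 1)) ?_)
          rw [div_mul_eq_mul_div]
          apply div_le_div_of_nonneg_right _ hGpos.le
          have : ((i + 1 : ℕ) : ℚ) ≤ ((j0 + 1 : ℕ) : ℚ) := by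
            exact_mod_cast (by omega : i + 1 ≤ j0 + 1)
          have hM0 : (0 : ℚ) ≤ M := Nat.cast_nonneg M
          push_cast at this ⊢
          nlinarith
        · obtain ⟨t, rfl⟩ : ∃ t, i = j0 + t := ⟨i - j0, by omega⟩
          refine le_trans (abs_seqSum_le_growth hx hq hR hm0M hMT hj0 t) ?_
          apply div_le_div_of_nonneg_right _ hGpos.le
          have : (t : ℚ) ≤ ((d + 1 : ℕ) : ℚ) := by exact_mod_cast (by omega : t ≤ d + 1)
          have hM0 : (0 : ℚ) ≤ M := Nat.cast_nonneg M
          nlinarith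
      have e : (((M * (j0 + 2) + 2 * (M * (d + 1)) : ℕ) : ℚ))
          = (((M : ℚ) * ((j0 + 1 : ℕ) : ℚ) + 2 * M * ((d + 1 : ℕ) : ℚ)) / 2 ^ G + (M : ℚ) / 2 ^ G)
            * 2 ^ G := by
        field_simp; push_cast; ring
      rw [e]
      exact mul_le_mul_of_nonneg_right (by linarith) hGpos.le

/-- THE WINDOW LAW: every grid alphabet and precision `manBits ≥ 3`, `Q ≥ 4M + 5`, EVERY word and
every `k = d + 1 ≤ T/2 + 4`: `R(x, j₀+1+d) ≤ max((d+1)/(B+d+1), (d+1)/(T+d+1))`.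
[cell, gemm.tex Prop. p:fpW] -/
theorem relErr_le_window_all {j0 Bn Q d : ℕ} (hm : 3 ≤ φ.manBits)
    (hj0 : M * j0 + m0 < 2 ^ (φ.manBits + 1))
    (hB : (∑ i ∈ range (j0 + 2), zl G x i) % 2 ≠ 0 →
      2 ^ (φ.manBits + 1) < (∑ i ∈ range (j0 + 2), zl G x i).natAbs →
      ((Bn : ℚ) + 1) / 2 ^ G ≤ ∑ i ∈ range (j0 + 2), |x i|)
    (hQ : M * (j0 + 2) + Q = 2 * 2 ^ (φ.manBits + 1)) (hQM : 4 * M + 5 ≤ Q)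
    (hd : d + 1 ≤ 2 ^ φ.manBits + 4) :
    relErr φ x (j0 + 1 + d) ≤ max (((d + 1 : ℕ) : ℚ) / ((Bn : ℚ) + ((d + 1 : ℕ) : ℚ)))
      (((d + 1 : ℕ) : ℚ) / (2 ^ (φ.manBits + 1) + ((d + 1 : ℕ) : ℚ))) := by
  classical
  have hGpos : (0 : ℚ) < 2 ^ G := by positivity
  have hmono : (d : ℚ) / (2 ^ (φ.manBits + 1) + d)
      ≤ ((d + 1 : ℕ) : ℚ) / (2 ^ (φ.manBits + 1) + ((d + 1 : ℕ) : ℚ)) := by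
    have hT0 : (0 : ℚ) < 2 ^ (φ.manBits + 1) := by positivity
    have hd0 : (0 : ℚ) ≤ d := Nat.cast_nonneg d
    rw [div_le_div_iff₀ (by positivity) (by positivity)]
    push_cast
    nlinarith
  have hmax0 : 0 ≤ max (((d + 1 : ℕ) : ℚ) / ((Bn : ℚ) + ((d + 1 : ℕ) : ℚ)))
      (((d + 1 : ℕ) : ℚ) / (2 ^ (φ.manBits + 1) + ((d + 1 : ℕ) : ℚ))) :=
    le_trans (by positivity) (le_max_right _ _)
  -- EITHER the word is low up to `j₀ + d` (file LXIII-a) …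
  by_cases hex : ∃ j, j0 ≤ j ∧ j < j0 + (d + 1) ∧
      2 ^ (φ.manBits + 2) / 2 ^ G ≤ |(seqSum φ x j).toRat + x (j + 1)|
  swap
  · have hall : ∀ j, j0 ≤ j → j < j0 + (d + 1) →
        |(seqSum φ x j).toRat + x (j + 1)| < 2 ^ (φ.manBits + 2) / 2 ^ G :=
      fun j h1 h2 => lt_of_not_ge fun h => hex ⟨j, h1, h2, h⟩
    have h := lowInvG_of_low hx hq hR hm0M hMT hj0 hB (d + 1) hall
    rw [show j0 + (d + 1) = j0 + 1 + d by ring] at h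
    exact le_trans (relErr_le_of_lowInvG h) (max_le_max le_rfl hmono)
  -- … OR it is high: pass to the integer model `accZ` and apply the window theorem
  obtain ⟨j, hj1, hj2, hj3⟩ := hex
  have hbr := toRat_seqSum_eq_accZ_window hx hq hR hm0M hMT hME hm hj0 hQ hd
  have hxz := zl_spec hx
  have hV : ∀ i, i < j0 + 1 + d → (seqSum φ x i).toRat + x (i + 1)
      = ((accZ φ.manBits (zl G x) i + zl G x (i + 1) : ℤ) : ℚ) / 2 ^ G := by
    intro i hi
    rw [hbr i (by omega), (hxz (i + 1)).1]; push_cast; ring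
  have hLsum : ∀ k, (∑ i ∈ range k, (zl G x i).natAbs) ≤ M * k := by
    intro k
    induction k with
    | zero => simp
    | succ k ih => rw [sum_range_succ, Nat.mul_succ]; exact Nat.add_le_add ih (hxz k).2.1
  have hsabs : ∀ k, (∑ i ∈ range (k + 1), zl G x i).natAbs ≤ M * (k + 1) := by
    intro k
    have h1 := abs_sZ_le_LZ (zl G x) k
    unfold sZ LZ at h1
    rw [Int.abs_eq_natAbs, ← Nat.cast_sum] at h1
    have h3 : ((∑ i ∈ range (k + 1), zl G x i).natAbs : ℤ) ≤ ((M * (k + 1) : ℕ) : ℤ) :=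
      le_trans h1 (by exact_mod_cast hLsum (k + 1))
    exact_mod_cast h3
  have hacc : ∀ i, i < j0 + 1 + d → accZ φ.manBits (zl G x) (i + 1)
      = rneZ φ.manBits (accZ φ.manBits (zl G x) i + zl G x (i + 1)) := fun i _ => rfl
  have hpre : accZ φ.manBits (zl G x) j0 = sZ (zl G x) j0 := by
    have h1 := hbr j0 (by omega)
    rw [seqSum_exact_prefixG hx hq hR hm0M hMT hj0 j0 le_rfl, sum_eq_zlG hx j0,
      div_left_inj' (ne_of_gt hGpos)] at h1
    unfold sZ
    exact_mod_cast h1.symm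
  have hT2N : 2 ^ (φ.manBits + 2) = 2 * 2 ^ (φ.manBits + 1) := by rw [pow_succ]; ring
  have e1 : M * (j0 + 2) = M * (j0 + 1) + M := by ring
  -- the exact prefix is even or below `T`, and at most `2T`
  have hs0 : (accZ φ.manBits (zl G x) j0).natAbs ≤ M * (j0 + 1) := by
    rw [hpre]; exact hsabs j0
  have hP0 : (accZ φ.manBits (zl G x) j0).natAbs ≤ 2 ^ (φ.manBits + 2) := by omega
  have hKZ : ((∑ i ∈ range (j0 + 1), zl G x i) % 2 = 0 ∧
      (∑ i ∈ range (j0 + 1), zl G x i).natAbs ≤ M * (j0 + 1)) ∨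
      (∑ i ∈ range (j0 + 1), zl G x i).natAbs ≤ M * j0 + m0 := KZ_shapeG hx hm0M j0
  have hP0r : (2 : ℤ) ∣ accZ φ.manBits (zl G x) j0 ∨
      (accZ φ.manBits (zl G x) j0).natAbs < 2 ^ (φ.manBits + 1) := by
    rw [hpre]; unfold sZ
    rcases hKZ with ⟨hev, -⟩ | hle
    · exact Or.inl (Int.dvd_of_emod_eq_zero hev)
    · exact Or.inr (by omega)
  -- the first five arguments after the prefix stay below `2T` (`Q ≥ 4M + 5`)
  have haccb : ∀ r, r ≤ 4 → j0 + r < j0 + 1 + d →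
      (accZ φ.manBits (zl G x) (j0 + r)).natAbs + M ≤ M * (j0 + 2) + r * (M + 1) := by
    intro r
    induction r with
    | zero => intro _ _; rw [Nat.add_zero, Nat.zero_mul, Nat.add_zero]; omega
    | succ r ih =>
        intro hr hlt
        have h0 := ih (by omega) (by omega)
        have hz := (hxz (j0 + r + 1)).2.1
        have hrM : r * (M + 1) ≤ 4 * (M + 1) := Nat.mul_le_mul_right _ (by omega)
        have hna := Int.natAbs_add_le (accZ φ.manBits (zl G x) (j0 + r)) (zl G x (j0 + r + 1))
        have hVr : (accZ φ.manBits (zl G x) (j0 + r) + zl G x (j0 + r + 1)).natAbs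
            < 2 ^ (φ.manBits + 2) := by omega
        have h2 := rneZ_err_le (m := φ.manBits) 0
          (K := accZ φ.manBits (zl G x) (j0 + r) + zl G x (j0 + r + 1)) (by simpa using hVr)
        rw [← hacc (j0 + r) (by omega)] at h2
        simp only [pow_zero] at h2
        rw [show j0 + (r + 1) = j0 + r + 1 by omega]
        have e2 : (r + 1) * (M + 1) = r * (M + 1) + (M + 1) := by ring
        have hsub := Int.natAbs_sub_le (accZ φ.manBits (zl G x) (j0 + r + 1))
          (accZ φ.manBits (zl G x) (j0 + r) + zl G x (j0 + r + 1))
        omega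
  have hV5 : ∀ i, j0 ≤ i → i < j0 + 5 → i < j0 + 1 + d →
      (accZ φ.manBits (zl G x) i + zl G x (i + 1)).natAbs < 2 ^ (φ.manBits + 2) := by
    intro i h1 h2 h3
    obtain ⟨r, rfl⟩ : ∃ r, i = j0 + r := ⟨i - j0, by omega⟩
    have h0 := haccb r (by omega) h3
    have hz := (hxz (j0 + r + 1)).2.1
    have hrM : r * (M + 1) ≤ 4 * (M + 1) := Nat.mul_le_mul_right _ (by omega)
    have hna := Int.natAbs_add_le (accZ φ.manBits (zl G x) (j0 + r)) (zl G x (j0 + r + 1))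
    omega
  have hδ : ∀ i, i < j0 + 1 + d → (accZ φ.manBits (zl G x) (i + 1)
      - (accZ φ.manBits (zl G x) i + zl G x (i + 1))).natAbs ≤ (zl G x (i + 1)).natAbs := by
    intro i hi
    have h1 := abs_step_err_le_term (φ := φ) x i
    rw [hV i hi, hbr (i + 1) (by omega), (hxz (i + 1)).1, ← sub_div, abs_div, abs_div,
      abs_of_pos hGpos, div_le_div_iff_of_pos_right hGpos] at h1
    apply natAbs_le_of_abs_cast_le
    rw [Nat.cast_natAbs]
    push_cast
    exact_mod_cast h1
  have hhigh : ∃ i, j0 ≤ i ∧ i < j0 + 1 + d ∧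
      2 ^ (φ.manBits + 2) ≤ (accZ φ.manBits (zl G x) i + zl G x (i + 1)).natAbs := by
    refine ⟨j, hj1, by omega, le_natAbs_of_cast_le_abs ?_⟩
    rw [hV j (by omega), abs_div, abs_of_pos hGpos, div_le_div_iff_of_pos_right hGpos] at hj3
    exact_mod_cast hj3
  have hsp := windowZ_abs (by omega) (by omega) hacc hpre hP0 hP0r hV5 hδ hhigh
  -- back to `relErr`
  have hq' : ((2 : ℚ) ^ (φ.manBits + 1) + d + 1)
      * |((accZ φ.manBits (zl G x) (j0 + 1 + d) - sZ (zl G x) (j0 + 1 + d) : ℤ) : ℚ)|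
      ≤ ((d : ℚ) + 1) * ((LZ (zl G x) (j0 + 1 + d) : ℤ) : ℚ) := by
    exact_mod_cast hsp
  have e1 : ((LZ (zl G x) (j0 + 1 + d) : ℤ) : ℚ)
      = ((∑ i ∈ range (j0 + 1 + d + 1), (zl G x i).natAbs : ℕ) : ℚ) := by
    unfold LZ; rw [← Nat.cast_sum, Int.cast_natCast]
  have e2 : ((accZ φ.manBits (zl G x) (j0 + 1 + d) - sZ (zl G x) (j0 + 1 + d) : ℤ) : ℚ)
      = (accZ φ.manBits (zl G x) (j0 + 1 + d) : ℚ)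
        - ((∑ i ∈ range (j0 + 1 + d + 1), zl G x i : ℤ) : ℚ) := by
    unfold sZ; push_cast; rfl
  rw [e1, e2] at hq'
  unfold relErr
  rw [hbr (j0 + 1 + d) le_rfl, sum_eq_zlG hx (j0 + 1 + d), sum_abs_eq_natG hx (j0 + 1 + d + 1),
    ← sub_div, abs_div, abs_of_pos hGpos]
  by_cases hL : ((∑ i ∈ range (j0 + 1 + d + 1), (zl G x i).natAbs : ℕ) : ℚ) = 0
  · rw [hL, zero_div, div_zero]; exact hmax0
  have hLpos : (0 : ℚ) < ((∑ i ∈ range (j0 + 1 + d + 1), (zl G x i).natAbs : ℕ) : ℚ) :=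
    lt_of_le_of_ne (Nat.cast_nonneg _) (Ne.symm hL)
  rw [div_div_div_cancel_right₀ (ne_of_gt hGpos)]
  refine le_trans ?_ (le_max_right _ _)
  rw [div_le_iff₀ hLpos, div_mul_eq_mul_div, le_div_iff₀ (by positivity),
    show ((d + 1 : ℕ) : ℚ) = (d : ℚ) + 1 by push_cast; ring]
  linarith

end Grid

/-! ### The worst case over an alphabet -/

section RowsAll

variable {G M m0 E : ℕ} {φ : Format} {L : ℚ → Prop} {W : ℕ → ℚ}
variable
  (hL : ∀ q, L q → ∃ z : ℤ, q = (z : ℚ) / 2 ^ G ∧ z.natAbs ≤ M ∧ (z % 2 = 0 ∨ z.natAbs ≤ m0))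
  (hWge : ∀ m, ∃ x : ℕ → ℚ, (∀ j, L (x j)) ∧ W m = relErr φ x m)
  (hq : φ.qexp ≤ -(G : ℤ)) (hR : (2 : ℚ) ^ (φ.manBits + E + 3) ≤ φ.maxRat)
  (hm0M : m0 ≤ M) (hMT : M ≤ 2 ^ (φ.manBits + 1)) (hm0 : 1 ≤ m0) (hME : M ≤ 2 ^ (G + E))
include hL hWge hq hR hm0M hMT hm0 hME

/-- THE WINDOW ROW: `H_B` for every word of the alphabet, `Q ≥ 4M + 5`, `k = d + 1 ≤ T/2 + 4`
give `W(j₀+1+d) ≤ max((d+1)/(B+d+1), (d+1)/(T+d+1))`. [cell, gemm.tex Prop. p:fpW] -/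
theorem gridW_le_window_all {j0 Bn Q d : ℕ} (hm : 3 ≤ φ.manBits)
    (hj0 : M * j0 + m0 < 2 ^ (φ.manBits + 1))
    (hBall : ∀ x : ℕ → ℚ, (∀ j, L (x j)) → (∑ i ∈ range (j0 + 2), zl G x i) % 2 ≠ 0 →
      2 ^ (φ.manBits + 1) < (∑ i ∈ range (j0 + 2), zl G x i).natAbs →
      ((Bn : ℚ) + 1) / 2 ^ G ≤ ∑ i ∈ range (j0 + 2), |x i|)
    (hQ : M * (j0 + 2) + Q = 2 * 2 ^ (φ.manBits + 1)) (hQM : 4 * M + 5 ≤ Q)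
    (hd : d + 1 ≤ 2 ^ φ.manBits + 4) :
    W (j0 + 1 + d) ≤ max (((d + 1 : ℕ) : ℚ) / ((Bn : ℚ) + ((d + 1 : ℕ) : ℚ)))
      (((d + 1 : ℕ) : ℚ) / (2 ^ (φ.manBits + 1) + ((d + 1 : ℕ) : ℚ))) := by
  obtain ⟨x, hx, hW⟩ := hWge (j0 + 1 + d)
  rw [hW]
  exact relErr_le_window_all (fun j => hL _ (hx j)) hq hR hm0M hMT hm0 hME hm hj0
    (hBall x hx) hQ hQM hd

end RowsAll

end Summit.Ventures.CertifiedArithmetic.LowPrec.Gemm
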